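import Literature.NumberTheory.GaloisRepresentations.ContinuousCohomologyConnecting
import HarnessLib

/-!
# Compatibilities of the cup product `H¹ × H¹ → H²` on continuous cohomology

For the cup product of the tree's `ContinuousCupProduct.lean` (Mathlib continuous cohomology,
bidegree `(1, 1)`, attached to a continuous equivariant pairing `⟨ , ⟩ : X × Y → Z`), this file
proves the standard compatibilities (Neukirch–Schmidt–Wingberg, *Cohomology of Number Fields*,
I §4: (1.4.2) functoriality, (1.4.3) compatibility with the connecting homomorphisms,
(1.4.4) graded commutativity; Serre, *Cohomologie galoisienne*, I §2.2; Cartan–Eilenberg XII for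
abstract groups), all by identities of inhomogeneous cocycles (`ContinuousH2.lean`:
`(f ∪ g)(σ, τ) = ⟨f σ, σ g τ⟩`):

* **naturality** in morphisms of pairings, covariant (`cupProduct_map`:
  `H²(γ)(a ∪ b) = H¹(α) a ∪ H¹(β) b` when `γ⟨x, y⟩ = ⟨α x, β y⟩`) and adjoint
  (`cupProduct_adjoint`: `H¹(α) a ∪ b = a ∪ H¹(β) b` when `⟨α x, y⟩ = ⟨x, β y⟩`);
* **restriction** along a continuous homomorphism `θ : H → G` (`cupProduct_res`);
* the pairing with an invariant element, `ContPairing.leftHom x : Y ⟶ Z`, `y ↦ ⟨x, y⟩` (the cup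
  product `H⁰ × H² → H²` with the class of `x` is `H²(leftHom x)`);
* **compatibility with connecting homomorphisms** (`cupProduct_δ₀_eq_neg_map_δ₁`): for short exact
  sequences `0 → M₁ → M → W → 0`, `0 → W' → M' → M₁' → 0` of discrete modules and pairings
  `M × M' → Ω`, `M₁ × M₁' → Ω`, `W × W' → Ω` compatible with the maps
  (`⟨i m₁, φ⟩ = ⟨m₁, π' φ⟩`, `⟨m, i' ψ⟩ = ⟨π m, ψ⟩`), one has, for `x ∈ W^Γ` and `y ∈ H¹(Γ, M₁')`,
  `δ₀ x ∪ y = - H²(leftHom x)(δ₁ y)` in `H²(Γ, Ω)` (the cochain identity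
  `(δ₀x ∪ y) + ⟨x, δ₁ y⟩ = d(σ ↦ ⟨x̃, ỹ σ⟩)`);
* **graded commutativity** in bidegree `(1, 1)` (`cupProduct_comm`: `a ∪ b = -(b ∪' a)` for the
  flipped pairing; cochain identity `(f ∪ g) + (g ∪' f) = -d(σ ↦ ⟨f σ, g σ⟩)`).

These are the inputs of the dévissage proof of local Tate duality (Serre, *Cohomologie
galoisienne*, II §5.2 Thm. 2; Milne, *Arithmetic Duality Theorems*, I Cor. 2.3).

## References

* J. Neukirch, A. Schmidt, K. Wingberg, *Cohomology of Number Fields*, 2nd ed. (2008), I §4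
  (cup products: functoriality, connecting homomorphisms, graded commutativity).
  [NeukirchSchmidtWingberg2008]
* J.-P. Serre, *Cohomologie galoisienne*, 5e éd. (1994) / *Galois Cohomology* (1997), I §2.2.
  [SerreGaloisCohomology1997]
-/

noncomputable section

open CategoryTheory Limits Function

universe u v

namespace Literature.NumberTheory.GaloisRepresentations

open _root_.TopRep _root_.ContRepresentation _root_.ContinuousCohomology

set_option allowUnsafeReducibility true in
attribute [local reducible] CategoryTheory.Functor.mapHomologicalComplex

/-! ### `σ f(τ) = f(στ) - f(σ)` for crossed homomorphisms -/

section CrossedHom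

variable {R : Type u} [CommRing R] [TopologicalSpace R]
variable {G : Type v} [Group G] [TopologicalSpace G] {X : TopRep.{v} R G}

/-- `g f(h) = f(g h) - f(g)` for a crossed homomorphism `f`. [folklore] -/
theorem contOneCocycles.apply_smul_eq (f : contOneCocycles X) (g h : G) :
    X.ρ g (f.1 h) = f.1 (g * h) - f.1 g := by
  rw [f.2 g h, add_sub_cancel_left]

end CrossedHom

namespace ContPairing

/-! ### Naturality in the pairing -/

section Naturality

variable {R : Type u} [CommRing R] [TopologicalSpace R]
variable {G : Type v} [Group G] [TopologicalSpace G] [IsTopologicalGroup G] [LocallyCompactSpace G]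
variable {X₁ Y₁ Z₁ X₂ Y₂ Z₂ : TopRep.{v} R G}

omit [LocallyCompactSpace G] in
/-- Covariant naturality of the cup-product cocycle: if `γ⟨x, y⟩₁ = ⟨α x, β y⟩₂` then
`γ ∘ (f ∪₁ g) = (α ∘ f) ∪₂ (β ∘ g)`. [cite: NeukirchSchmidtWingberg2008, I §4 (1.4.2)] -/
theorem cupCocycle_map (P₁ : ContPairing X₁ Y₁ Z₁) (P₂ : ContPairing X₂ Y₂ Z₂)
    (α : X₁ ⟶ X₂) (β : Y₁ ⟶ Y₂) (γ : Z₁ ⟶ Z₂)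
    (hc : ∀ x y, γ.hom (P₁.toLin x y) = P₂.toLin (α.hom x) (β.hom y))
    (f : contOneCocycles X₁) (g : contOneCocycles Y₁) :
    contTwoCocycles.pullback (ContinuousMonoidHom.id G) (resIdHom γ) (P₁.cupCocycle f g) =
      P₂.cupCocycle (contOneCocycles.pullback (ContinuousMonoidHom.id G) (resIdHom α) f)
        (contOneCocycles.pullback (ContinuousMonoidHom.id G) (resIdHom β) g) := by
  refine Subtype.ext (ContinuousMap.ext fun p => ?_)
  obtain ⟨σ, τ⟩ := p
  rw [pullback₂_id_resIdHom_apply, cupCocycle_apply, cupCocycle_apply, hc,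
    pullback_id_resIdHom_apply, pullback_id_resIdHom_apply, pullback_id_resIdHom_apply, map_sub]

/-- **Covariant naturality of the cup product**: if `γ⟨x, y⟩₁ = ⟨α x, β y⟩₂` then
`H²(γ)(a ∪₁ b) = H¹(α) a ∪₂ H¹(β) b`. [cite: NeukirchSchmidtWingberg2008, I §4 (1.4.2)] -/
theorem cupProduct_map (P₁ : ContPairing X₁ Y₁ Z₁) (P₂ : ContPairing X₂ Y₂ Z₂)
    (α : X₁ ⟶ X₂) (β : Y₁ ⟶ Y₂) (γ : Z₁ ⟶ Z₂)
    (hc : ∀ x y, γ.hom (P₁.toLin x y) = P₂.toLin (α.hom x) (β.hom y))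
    (a : continuousCohomology 1 X₁) (b : continuousCohomology 1 Y₁) :
    cohomologyMap γ 2 (P₁.cupProduct a b) =
      P₂.cupProduct (cohomologyMap α 1 a) (cohomologyMap β 1 b) := by
  obtain ⟨f, rfl⟩ := oneCocycleClass_surjective _ a
  obtain ⟨g, rfl⟩ := oneCocycleClass_surjective _ b
  rw [cupProduct_oneCocycleClass_eq_twoCocycleClass, cohomologyMap_twoCocycleClass,
    cupCocycle_map P₁ P₂ α β γ hc, cohomologyMap_oneCocycleClass, cohomologyMap_oneCocycleClass,
    cupProduct_oneCocycleClass_eq_twoCocycleClass]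

variable {Z : TopRep.{v} R G}

omit [LocallyCompactSpace G] in
/-- Adjoint naturality of the cup-product cocycle: if `⟨α x, y⟩₂ = ⟨x, β y⟩₁` then
`(α ∘ f) ∪₂ g = f ∪₁ (β ∘ g)`. [cite: NeukirchSchmidtWingberg2008, I §4 (1.4.2)] -/
theorem cupCocycle_adjoint (P₁ : ContPairing X₁ Y₁ Z) (P₂ : ContPairing X₂ Y₂ Z)
    (α : X₁ ⟶ X₂) (β : Y₂ ⟶ Y₁) (hc : ∀ x y, P₂.toLin (α.hom x) y = P₁.toLin x (β.hom y))
    (f : contOneCocycles X₁) (g : contOneCocycles Y₂) :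
    P₂.cupCocycle (contOneCocycles.pullback (ContinuousMonoidHom.id G) (resIdHom α) f) g =
      P₁.cupCocycle f (contOneCocycles.pullback (ContinuousMonoidHom.id G) (resIdHom β) g) := by
  refine Subtype.ext (ContinuousMap.ext fun p => ?_)
  obtain ⟨σ, τ⟩ := p
  rw [cupCocycle_apply, cupCocycle_apply, pullback_id_resIdHom_apply, hc,
    pullback_id_resIdHom_apply, pullback_id_resIdHom_apply, map_sub]

/-- **Adjoint naturality of the cup product**: if `⟨α x, y⟩₂ = ⟨x, β y⟩₁` for `α : X₁ → X₂`,
`β : Y₂ → Y₁`, then `H¹(α) a ∪₂ b = a ∪₁ H¹(β) b` in `H²(G, Z)`.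
[cite: NeukirchSchmidtWingberg2008, I §4 (1.4.2)] -/
theorem cupProduct_adjoint (P₁ : ContPairing X₁ Y₁ Z) (P₂ : ContPairing X₂ Y₂ Z)
    (α : X₁ ⟶ X₂) (β : Y₂ ⟶ Y₁) (hc : ∀ x y, P₂.toLin (α.hom x) y = P₁.toLin x (β.hom y))
    (a : continuousCohomology 1 X₁) (b : continuousCohomology 1 Y₂) :
    P₂.cupProduct (cohomologyMap α 1 a) b = P₁.cupProduct a (cohomologyMap β 1 b) := by
  obtain ⟨f, rfl⟩ := oneCocycleClass_surjective _ a
  obtain ⟨g, rfl⟩ := oneCocycleClass_surjective _ b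
  rw [cohomologyMap_oneCocycleClass, cohomologyMap_oneCocycleClass,
    cupProduct_oneCocycleClass_eq_twoCocycleClass,
    cupProduct_oneCocycleClass_eq_twoCocycleClass, cupCocycle_adjoint P₁ P₂ α β hc]

end Naturality

/-! ### Restriction along a continuous homomorphism -/

section Restriction

variable {R : Type u} [CommRing R] [TopologicalSpace R]
variable {G : Type v} [Group G] [TopologicalSpace G] [IsTopologicalGroup G] [LocallyCompactSpace G]
variable {H : Type v} [Group H] [TopologicalSpace H] [IsTopologicalGroup H] [LocallyCompactSpace H]
variable {X Y Z : TopRep.{v} R G} (P : ContPairing X Y Z) (θ : H →ₜ* G)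

omit [LocallyCompactSpace G] [LocallyCompactSpace H] in
/-- The cup-product cocycle restricts to the cup product of the restrictions.
[cite: NeukirchSchmidtWingberg2008, I §4 (1.4.2)] -/
theorem cupCocycle_res (f : contOneCocycles X) (g : contOneCocycles Y) :
    contTwoCocycles.pullback θ (𝟙 (TopRep.res (θ : H →* G) Z)) (P.cupCocycle f g) =
      (P.restrict θ).cupCocycle (contOneCocycles.pullback θ (𝟙 (TopRep.res (θ : H →* G) X)) f)
        (contOneCocycles.pullback θ (𝟙 (TopRep.res (θ : H →* G) Y)) g) := by
  refine Subtype.ext (ContinuousMap.ext fun p => ?_)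
  obtain ⟨σ, τ⟩ := p
  rw [contTwoCocycles.pullback_apply, cupCocycle_apply, cupCocycle_apply,
    contOneCocycles.pullback_apply, contOneCocycles.pullback_apply,
    contOneCocycles.pullback_apply, _root_.map_mul θ]
  rfl

/-- **The cup product commutes with restriction** along a continuous homomorphism `θ : H → G`:
`res (a ∪ b) = res a ∪ res b`. [cite: NeukirchSchmidtWingberg2008, I §4 (1.4.2)] -/
theorem cupProduct_res (a : continuousCohomology 1 X) (b : continuousCohomology 1 Y) :
    ContinuousCohomology.map θ (𝟙 (TopRep.res (θ : H →* G) Z)) 2 (P.cupProduct a b) =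
      (P.restrict θ).cupProduct
        (ContinuousCohomology.map θ (𝟙 (TopRep.res (θ : H →* G) X)) 1 a)
        (ContinuousCohomology.map θ (𝟙 (TopRep.res (θ : H →* G) Y)) 1 b) := by
  obtain ⟨f, rfl⟩ := oneCocycleClass_surjective _ a
  obtain ⟨g, rfl⟩ := oneCocycleClass_surjective _ b
  rw [cupProduct_oneCocycleClass_eq_twoCocycleClass, map_twoCocycleClass, cupCocycle_res,
    map_oneCocycleClass, map_oneCocycleClass, cupProduct_oneCocycleClass_eq_twoCocycleClass]

end Restriction

/-! ### Pairing with an invariant element (`H⁰ × Hⁿ → Hⁿ`) -/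

section LeftHom

variable {R : Type u} [CommRing R] [TopologicalSpace R]
variable {G : Type v} [Group G]
variable {X Y Z : TopRep.{v} R G} (P : ContPairing X Y Z)

/-- **Pairing with a `G`-invariant `x ∈ X`**: the morphism of topological representations
`Y ⟶ Z`, `y ↦ ⟨x, y⟩` (equivariant as `⟨x, g y⟩ = ⟨g x, g y⟩ = g ⟨x, y⟩`).  The cup product
`H⁰(G, X) × Hⁿ(G, Y) → Hⁿ(G, Z)` with the class of `x` is `Hⁿ(leftHom x)`.
[cite: NeukirchSchmidtWingberg2008, I §4] -/
def leftHom (x : X) (hx : ∀ g : G, X.ρ g x = x) : Y ⟶ Z :=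
  TopRep.ofHom
    { toLinearMap := P.toLin x
      cont := P.continuous_toLin.comp (continuous_const.prodMk continuous_id)
      isIntertwining' := fun g => ContinuousLinearMap.ext fun y => by
        change P.toLin x (Y.ρ g y) = Z.ρ g (P.toLin x y)
        rw [← P.toLin_smul, hx] }

/-- Unfolding `leftHom`. [folklore] -/
@[simp] theorem leftHom_hom_apply (x : X) (hx : ∀ g : G, X.ρ g x = x) (y : Y) :
    (P.leftHom x hx).hom y = P.toLin x y := rfl

/-- **Pairing with a `G`-invariant `y ∈ Y`** on the right: `X ⟶ Z`, `x ↦ ⟨x, y⟩`.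
[cite: NeukirchSchmidtWingberg2008, I §4] -/
def rightHom (y : Y) (hy : ∀ g : G, Y.ρ g y = y) : X ⟶ Z :=
  TopRep.ofHom
    { toLinearMap := P.toLin.flip y
      cont := P.continuous_toLin.comp (continuous_id.prodMk continuous_const)
      isIntertwining' := fun g => ContinuousLinearMap.ext fun x => by
        change P.toLin (X.ρ g x) y = Z.ρ g (P.toLin x y)
        rw [← P.toLin_smul, hy] }

/-- Unfolding `rightHom`. [folklore] -/
@[simp] theorem rightHom_hom_apply (y : Y) (hy : ∀ g : G, Y.ρ g y = y) (x : X) :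
    (P.rightHom y hy).hom x = P.toLin x y := rfl

/-- **The flipped pairing** `Y × X → Z`, `(y, x) ↦ ⟨x, y⟩`. [folklore] -/
def flip : ContPairing Y X Z where
  toLin := P.toLin.flip
  continuous_toLin := P.continuous_toLin.comp (continuous_snd.prodMk continuous_fst)
  toLin_smul g y x := P.toLin_smul g x y

/-- Unfolding `flip`. [folklore] -/
@[simp] theorem flip_toLin_apply (y : Y) (x : X) : P.flip.toLin y x = P.toLin x y := rfl

end LeftHom

/-! ### Graded commutativity in bidegree `(1, 1)` -/

section Comm

variable {R : Type u} [CommRing R] [TopologicalSpace R]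
variable {G : Type v} [Group G] [TopologicalSpace G] [IsTopologicalGroup G] [LocallyCompactSpace G]
variable {X Y Z : TopRep.{v} R G} (P : ContPairing X Y Z)

/-- **Graded commutativity of the cup product in bidegree `(1, 1)`**, on cocycles:
`[f ∪ g] + [g ∪' f] = 0` for the flipped pairing `∪'`, by the cochain identity
`(f ∪ g)(σ, τ) + (g ∪' f)(σ, τ) = -(d c)(σ, τ)`, `c(σ) = ⟨f σ, g σ⟩`.
[cite: NeukirchSchmidtWingberg2008, I §4 (1.4.4)] -/
theorem twoCocycleClass_cupCocycle_add_flip (f : contOneCocycles X) (g : contOneCocycles Y) :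
    twoCocycleClass Z (P.cupCocycle f g) + twoCocycleClass Z (P.flip.cupCocycle g f) = 0 := by
  rw [← twoCocycleClass_add, twoCocycleClass_eq_zero_iff]
  refine ⟨-⟨fun σ => P.toLin (f.1 σ) (g.1 σ),
    P.continuous_toLin.comp (f.1.continuous.prodMk g.1.continuous)⟩, fun σ τ => ?_⟩
  change P.toLin (f.1 σ) (g.1 (σ * τ) - g.1 σ) + P.toLin (f.1 (σ * τ) - f.1 σ) (g.1 σ) =
    Z.ρ σ (-P.toLin (f.1 τ) (g.1 τ)) - -P.toLin (f.1 (σ * τ)) (g.1 (σ * τ)) +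
      -P.toLin (f.1 σ) (g.1 σ)
  rw [map_neg, ← P.toLin_smul, contOneCocycles.apply_smul_eq f, contOneCocycles.apply_smul_eq g]
  simp only [map_sub, LinearMap.sub_apply]
  abel

/-- **Graded commutativity of the cup product `H¹ × H¹ → H²`**: `a ∪ b = -(b ∪' a)`, where `∪'`
is the cup product of the flipped pairing `⟨y, x⟩' = ⟨x, y⟩`.
[cite: NeukirchSchmidtWingberg2008, I §4 (1.4.4)] -/
theorem cupProduct_comm (a : continuousCohomology 1 X) (b : continuousCohomology 1 Y) :
    P.cupProduct a b = -P.flip.cupProduct b a := by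
  obtain ⟨f, rfl⟩ := oneCocycleClass_surjective _ a
  obtain ⟨g, rfl⟩ := oneCocycleClass_surjective _ b
  rw [cupProduct_oneCocycleClass_eq_twoCocycleClass, cupProduct_oneCocycleClass_eq_twoCocycleClass,
    eq_neg_iff_add_eq_zero, twoCocycleClass_cupCocycle_add_flip]

end Comm

end ContPairing

/-! ### Compatibility with the connecting homomorphisms -/

section Connecting

variable {A : Type u} [CommRing A] [TopologicalSpace A]
variable {Γ : Type v} [Group Γ] [TopologicalSpace Γ] [IsTopologicalGroup Γ] [LocallyCompactSpace Γ]
-- the first short exact sequence `0 → M₁ → M → W → 0`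
variable {M₁ : Type v} [AddCommGroup M₁] [Module A M₁] [TopologicalSpace M₁] [DiscreteTopology M₁]
  [ContinuousSMul A M₁]
variable {M : Type v} [AddCommGroup M] [Module A M] [TopologicalSpace M] [DiscreteTopology M]
  [ContinuousSMul A M]
variable {W : Type v} [AddCommGroup W] [Module A W] [TopologicalSpace W] [DiscreteTopology W]
  [ContinuousSMul A W]
-- the second short exact sequence `0 → W' → M' → M₁' → 0`
variable {W' : Type v} [AddCommGroup W'] [Module A W'] [TopologicalSpace W'] [DiscreteTopology W']
  [ContinuousSMul A W']
variable {M' : Type v} [AddCommGroup M'] [Module A M'] [TopologicalSpace M'] [DiscreteTopology M']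
  [ContinuousSMul A M']
variable {M₁' : Type v} [AddCommGroup M₁'] [Module A M₁'] [TopologicalSpace M₁']
  [DiscreteTopology M₁'] [ContinuousSMul A M₁']
-- the target `Ω`
variable {Ω : Type v} [AddCommGroup Ω] [Module A Ω] [TopologicalSpace Ω] [DiscreteTopology Ω]
  [ContinuousSMul A Ω]
variable {ρ₁ : ContinuousRep Γ A M₁} {ρ : ContinuousRep Γ A M} {ρW : ContinuousRep Γ A W}
variable {ρW' : ContinuousRep Γ A W'} {ρ' : ContinuousRep Γ A M'} {ρ₁' : ContinuousRep Γ A M₁'}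
variable {ρΩ : ContinuousRep Γ A Ω}
variable {i : ρ₁.toTopRep ⟶ ρ.toTopRep} {π : ρ.toTopRep ⟶ ρW.toTopRep}
variable {i' : ρW'.toTopRep ⟶ ρ'.toTopRep} {π' : ρ'.toTopRep ⟶ ρ₁'.toTopRep}

/-- **Compatibility of the cup product with the connecting homomorphisms.**  Let
`0 → M₁ →(i) M →(π) W → 0` and `0 → W' →(i') M' →(π') M₁' → 0` be short exact sequences of
discrete `Γ`-modules and `⟨ , ⟩ : M × M' → Ω`, `⟨ , ⟩₁ : M₁ × M₁' → Ω`, `⟨ , ⟩_W : W × W' → Ω`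
pairings compatible with the maps: `⟨i m₁, φ⟩ = ⟨m₁, π' φ⟩₁` and `⟨m, i' ψ⟩ = ⟨π m, ψ⟩_W`.  Then
for `x ∈ W^Γ` and `y ∈ H¹(Γ, M₁')`,

  `δ₀ x ∪₁ y = - H²(⟨x, ·⟩_W)(δ₁ y)`  in `H²(Γ, Ω)`,

where `⟨x, ·⟩_W : W' → Ω` is `ContPairing.leftHom` (the cup product `H⁰ × H² → H²` with the class of
`x`).  Cochain identity: `(δ₀x ∪ y)(σ, τ) + ⟨x, δ₁y(σ, τ)⟩ = (d c)(σ, τ)` with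
`c(σ) = ⟨x̃, ỹ(σ)⟩` for lifts `x̃ ∈ M` of `x` and `ỹ : Γ → M'` of `y`.
Ref: Neukirch–Schmidt–Wingberg, *Cohomology of Number Fields* (2008), I §4 Prop. (1.4.3);
Milne, *Arithmetic Duality Theorems* (2006), proof of I Thm. 0.3 / Cor. 2.3 (dévissage diagram).
[cite: NeukirchSchmidtWingberg2008, I §4 (1.4.3)] -/
theorem cupProduct_δ₀_eq_neg_map_δ₁ (h : IsSES i π) (h' : IsSES i' π')
    (P : ContPairing ρ.toTopRep ρ'.toTopRep ρΩ.toTopRep)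
    (P₁ : ContPairing ρ₁.toTopRep ρ₁'.toTopRep ρΩ.toTopRep)
    (PW : ContPairing ρW.toTopRep ρW'.toTopRep ρΩ.toTopRep)
    (hc₁ : ∀ (m₁ : M₁) (φ : M'), P.toLin (i.hom m₁) φ = P₁.toLin m₁ (π'.hom φ))
    (hc₂ : ∀ (m : M) (ψ : W'), P.toLin m (i'.hom ψ) = PW.toLin (π.hom m) ψ)
    (x : ρW.toTopRep.ρ.invariants) (y : continuousCohomology 1 ρ₁'.toTopRep) :
    P₁.cupProduct (h.δ₀ x) y = -cohomologyMap (PW.leftHom x.1 x.2) 2 (h'.δ₁ y) := by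
  obtain ⟨φ, rfl⟩ := oneCocycleClass_surjective _ y
  -- lifts `x̃` of `x` and `ỹ = φ̃` of `φ`
  set xt := h.lift x.1 with hxt_def
  have hxt : π.hom xt = x.1 := h.g_lift _
  have hxinv : π.hom xt ∈ ρW.toTopRep.ρ.invariants := by rw [hxt]; exact x.2
  set φt := h'.liftCocycle φ with hφt_def
  rw [h.δ₀_apply_eq x xt hxt, ← h'.pushCocycle_liftCocycle φ, h'.δ₁_oneCocycleClass,
    ContPairing.cupProduct_oneCocycleClass_eq_twoCocycleClass, cohomologyMap_twoCocycleClass,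
    eq_neg_iff_add_eq_zero, ← twoCocycleClass_add, twoCocycleClass_eq_zero_iff]
  -- the `1`-cochain `c(σ) = ⟨x̃, φ̃ σ⟩`
  refine ⟨⟨fun σ => P.toLin xt (φt σ),
    P.continuous_toLin.comp (continuous_const.prodMk φt.continuous)⟩, fun σ τ => ?_⟩
  have hkerπ : π.hom (ρ σ xt - xt) = 0 := by
    rw [map_sub, ContinuousRep.hom_comm_apply π σ, hxt, sub_eq_zero]; exact x.2 σ
  have hkerπ' : π'.hom (ρ' σ (φt τ) - φt (σ * τ) + φt σ) = 0 := by
    rw [map_add, map_sub, ContinuousRep.hom_comm_apply π' σ, h'.g_liftCocycle_apply,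
      h'.g_liftCocycle_apply, h'.g_liftCocycle_apply, φ.2 σ τ]
    change ρ₁' σ (φ.1 τ) - (φ.1 σ + ρ₁' σ (φ.1 τ)) + φ.1 σ = 0
    abel
  -- the cup-product term
  have hcup : (P₁.cupCocycle (h.δ₀Cocycle xt hxinv)
      (IsSES.pushCocycle φt (h'.liftCocycle_isLift φ))).1 (σ, τ) =
      P.toLin (ρ σ xt - xt) (φt (σ * τ) - φt σ) := by
    rw [ContPairing.cupCocycle_apply, IsSES.pushCocycle_apply, IsSES.pushCocycle_apply, ← map_sub,
      ← hc₁, h.f_δ₀Cocycle_apply]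
  -- the `⟨x, δ₁ y⟩` term
  have hleft : (contTwoCocycles.pullback (ContinuousMonoidHom.id Γ) (resIdHom (PW.leftHom x.1 x.2))
      (h'.connectingCocycle φt (h'.liftCocycle_isLift φ))).1 (σ, τ) =
      P.toLin xt (ρ' σ (φt τ) - φt (σ * τ) + φt σ) := by
    rw [pullback₂_id_resIdHom_apply, ContPairing.leftHom_hom_apply]
    conv_lhs => rw [← hxt]
    rw [← hc₂, h'.f_connectingCocycle_apply]
  -- `⟨σ x̃ - x̃, i' ψ⟩ = ⟨σ x - x, ψ⟩ = 0`
  have hkey : P.toLin (ρ σ xt - xt) (ρ' σ (φt τ) - φt (σ * τ) + φt σ) = 0 := by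
    rw [← h'.f_inv hkerπ', hc₂, hkerπ, map_zero, LinearMap.zero_apply]
  change (P₁.cupCocycle (h.δ₀Cocycle xt hxinv)
      (IsSES.pushCocycle φt (h'.liftCocycle_isLift φ))).1 (σ, τ) +
    (contTwoCocycles.pullback (ContinuousMonoidHom.id Γ) (resIdHom (PW.leftHom x.1 x.2))
      (h'.connectingCocycle φt (h'.liftCocycle_isLift φ))).1 (σ, τ) =
    ρΩ σ (P.toLin xt (φt τ)) - P.toLin xt (φt (σ * τ)) + P.toLin xt (φt σ)
  rw [hcup, hleft]
  have hsmul : ρΩ σ (P.toLin xt (φt τ)) = P.toLin (ρ σ xt) (ρ' σ (φt τ)) :=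
    (P.toLin_smul σ xt (φt τ)).symm
  rw [hsmul, ← sub_eq_zero]
  have e : P.toLin (ρ σ xt - xt) (φt (σ * τ) - φt σ) +
        P.toLin xt (ρ' σ (φt τ) - φt (σ * τ) + φt σ) -
      (P.toLin (ρ σ xt) (ρ' σ (φt τ)) - P.toLin xt (φt (σ * τ)) + P.toLin xt (φt σ)) =
      -P.toLin (ρ σ xt - xt) (ρ' σ (φt τ) - φt (σ * τ) + φt σ) := by
    simp only [map_sub, map_add, LinearMap.sub_apply]
    abel
  rw [e, hkey, neg_zero]

end Connecting

end Literature.NumberTheory.GaloisRepresentations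

end
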